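import Literature.AlgebraicGeometry.HodgeTheory.SmoothProjectiveComponents
import Literature.AlgebraicGeometry.Motives.JacobianGaloisDescent
import Literature.AlgebraicGeometry.Motives.GoodReductionFormalFunctionsProofs
import Literature.AlgebraicGeometry.Motives.BaseChangeProofs
import Literature.AlgebraicGeometry.Motives.SmoothSeparablePoints
import Literature.NumberTheory.Automorphic.Liu2021.NablaGaloisDescent
import Mathlib.FieldTheory.Normal.Closure
import Mathlib.AlgebraicGeometry.Morphisms.Finite
import HarnessLib

/-!
# Liu 2021 §2.1, proof of the Proposition: «Let `k'` be a separable closure of `k`. Then `k'` splits `X`»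
# — a FINITE GALOIS extension splits a smooth projective scheme into geometrically irreducible pieces

[Liu2021] = Yifeng Liu, *Fourier–Jacobi cycles and arithmetic relative trace formula*, Camb. J. Math.
**9** (2021) = arXiv:2102.11518.  The proof of the Proposition of §2.1 (existence of the Albanese
variety, FJcycle.tex l. 1194–1200) begins: «Let `k'` be a separable closure of `k`. Then `k'` splits `X`
(Definition 2.1 (2)) […]. Put `X' := X_{k'}`.» — i.e. every connected component of `X_{k'}` is
geometrically connected.  For the Galois descent (`Liu2021/AlbaneseGaloisDescent`, finite Galois
extensions) one needs a FINITE Galois `L / k` that already splits `X`.  THIS FILE (PROOF FILE: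
theorems only, no definition, no named fact, sorry-free) proves it for `X` smooth of relative
dimension `d` and projective over a field `k` of characteristic zero:

* `exists_components_isColimit` — over ANY field, a smooth projective `X` of pure dimension `d` is
  the finite coproduct of its components `E_c ↪ X` (open and closed immersions onto the irreducible
  components; `E_c` integral, smooth of relative dimension `d`, projective) — the field-generic part
  of the tree's `HodgeTheory.exists_components_isSmoothProjective_isColimit` (stated there over `ℂ`).
* `isIso_appTop_of_section`, `isSmoothProjective_of_section` — an integral proper `L`-scheme with an
  `L`-rational point has `Γ(Z, 𝒪_Z) = L`, hence (tree `geometricallyConnected_of_isIso_appTop`,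
  `geometricallyIrreducible_of_geometricallyConnected_of_smoothOfRelativeDimension`) a smooth
  projective integral `L`-scheme with an `L`-point is a smooth projective geometrically irreducible
  VARIETY (`IsSmoothProjective`).
* `exists_isGalois_algHom` — finitely many finite extensions of `k` embed into one finite Galois
  extension (compositum of normal closures in an algebraic closure).
* `exists_isGalois_isColimit_isSmoothProjective` — **for `X` smooth of relative dimension `d` and
  projective over `k` (`char k = 0`), there is a finite Galois `L / k` such that `X_L = X ×_k L` is a
  finite coproduct of smooth projective geometrically irreducible `L`-varieties.**  Proof: each
  component of `X` has a point over a finite extension (tree `exists_algPoints_of_smooth`); let `L` be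
  finite Galois containing all these fields; a component `Z` of `X_L` maps onto a clopen subset of `X`
  (`X_L → X` is open — flat of finite presentation — and closed — finite), which therefore contains a
  whole component of `X` and with it one of the chosen points `x`; the points of `X_L` over `x` form
  ONE Galois orbit (`GaloisDescent.exists_gal_apply_eq`) containing an `L`-rational point, and Galois
  translates of `L`-rational points are `L`-rational; so `Z` has an `L`-point and is geometrically
  irreducible.

Use (cell pub-hodgecm2, TEAM hComp, row A0-DECITE): the «`k'` splits `X`» input of the de-citing of
`Liu2021.exists_albanese` at the consumer (`X_K` smooth projective over the CM field `E`).  HC_CM is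
NOT proved; nothing here discharges any COR-CM binder.

Relies on: nothing unproved (axioms `propext`, `Classical.choice`, `Quot.sound`).

## References

* [Liu2021] Y. Liu, arXiv:2102.11518 = Camb. J. Math. 9 (2021), §2.1 Def. 2.1 (2) (FJcycle.tex
  l. 1175–1177), Proposition (l. 1190–1192) with proof (l. 1194–1200).
* [GortzWedhorn2020] U. Görtz, T. Wedhorn, *Algebraic Geometry I*, 2nd ed. (2020), Exercise 3.16,
  Prop. 5.51, §(14.20).
* [Liu2002] Q. Liu, *Algebraic Geometry and Arithmetic Curves* (2002), §3.2 Prop. 2.20 (points over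
  a finite separable extension), Prop. 3.1.23.
-/

noncomputable section

open CategoryTheory CategoryTheory.Limits AlgebraicGeometry MonoidalCategory CartesianMonoidalCategory
open Literature.AlgebraicGeometry.Motives Literature.AlgebraicGeometry.HodgeTheory

universe u

namespace Literature.NumberTheory.Automorphic.Liu2021.AppendixC

open AbelianVariety (bcSpec bcFunctor specAut specAut_comp_specAut_symm)

set_option backward.isDefEq.respectTransparency false

/-- Pointwise form of an equation of composites: `g (f a) = h a` if `f ≫ g = h` (private helper). [folklore] -/
private theorem apply_apply_of_comp_eq {A B C : Scheme.{u}} {f : A ⟶ B} {g : B ⟶ C} {h : A ⟶ C}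
    (e : f ≫ g = h) (a : ↥A) : g (f a) = h a := by
  rw [← e, Scheme.Hom.comp_apply]

/-! ### The components of a smooth projective scheme over any field -/

/-- **A pure-dimensional smooth projective scheme over a field is the finite coproduct of its
components.**  For `X` smooth of relative dimension `d` over `K` and projective, the open subschemes
`E_c` on the irreducible components are open AND closed (the local rings of the smooth `X` are domains,
Görtz–Wedhorn I Ex. 3.16; finitely many, `X` being Noetherian), integral, smooth of relative dimension
`d`, projective, their images are the irreducible components, and the cofan `(E_c ⟶ X)_c` is a colimit
in `SchemeOver K` (Mathlib `nonempty_isColimit_cofanMk_of`; `Over.forget` creates colimits).  The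
field-generic part of `HodgeTheory.exists_components_isSmoothProjective_isColimit`.
[cite: GortzWedhorn2020, Exercise 3.16 (p. 117)] [cite: StacksProject, Tag 0BA8] -/
theorem exists_components_isColimit {K : Type u} [Field K] {d : ℕ} (X : SchemeOver K)
    [SmoothOfRelativeDimension d X.hom] (hX : IsProjectiveOver X) :
    ∃ (C : Type u) (_ : Finite C) (E : C → SchemeOver K) (e : ∀ c, E c ⟶ X),
      (∀ c, SmoothOfRelativeDimension d (E c).hom) ∧ (∀ c, IsProjectiveOver (E c)) ∧
      (∀ c, IsIntegral (E c).left) ∧ (∀ c, IsOpenImmersion (e c).left) ∧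
      (∀ c, IsClopen (Set.range ⇑(e c).left)) ∧ (∀ c, IsIrreducible (Set.range ⇑(e c).left)) ∧
      Nonempty (IsColimit (Cofan.mk X e)) := by
  classical
  haveI : IsProper X.hom := hX.isProper
  haveI : IsLocallyNoetherian X.left := LocallyOfFiniteType.isLocallyNoetherian X.hom
  haveI : CompactSpace X.left := (quasiCompact_iff_compactSpace X.hom).mp inferInstance
  haveI : IsNoetherian X.left := { }
  have hdom : ∀ x : X.left, IsDomain (X.left.presheaf.stalk x) := fun x ↦
    isDomain_stalk_of_smoothOfRelativeDimension X.hom d x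
  haveI : IsReduced X.left := isReduced_of_smoothOfRelativeDimension X.hom d
  set C := irreducibleComponents X.left with hC
  haveI hfin : Finite C :=
    (TopologicalSpace.NoetherianSpace.finite_irreducibleComponents (α := X.left)).to_subtype
  have hopen : ∀ Z : C, IsOpen (Z.1 : Set X.left) := fun Z ↦
    isOpen_of_mem_irreducibleComponents_of_isDomain_stalk hdom Z.2
  let U : C → X.left.Opens := fun Z ↦ ⟨Z.1, hopen Z⟩
  let EZ : C → SchemeOver K := fun Z ↦ Over.mk ((U Z).ι ≫ X.hom)
  let eZ : ∀ Z : C, EZ Z ⟶ X := fun Z ↦ Over.homMk (U Z).ι rfl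
  haveI heZopen : ∀ Z : C, IsOpenImmersion (eZ Z).left := fun Z ↦
    inferInstanceAs (IsOpenImmersion (U Z).ι)
  have hrangeZ : ∀ Z : C, Set.range ⇑(eZ Z).left = (Z.1 : Set X.left) := fun Z ↦
    Scheme.Opens.range_ι _
  have hopensRange : ∀ Z : C, (eZ Z).left.opensRange = U Z := fun Z ↦ Scheme.Opens.opensRange_ι _
  haveI heZclosed : ∀ Z : C, IsClosedImmersion (eZ Z).left := fun Z ↦ by
    refine IsClosedImmersion.of_isPreimmersion _ ?_
    rw [hrangeZ]
    exact isClosed_of_mem_irreducibleComponents _ Z.2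
  have hsm : ∀ Z : C, SmoothOfRelativeDimension d (EZ Z).hom := fun Z ↦
    IsZariskiLocalAtSource.comp (P := @SmoothOfRelativeDimension d) ‹_› (U Z).ι
  have hproj : ∀ Z : C, IsProjectiveOver (EZ Z) := fun Z ↦
    Literature.AlgebraicGeometry.Resolution.isProjectiveOver_of_isClosedImmersion_left (eZ Z) hX
  have hint : ∀ Z : C, IsIntegral (EZ Z).left := fun Z ↦ by
    haveI : IrreducibleSpace (EZ Z).left := by
      change IrreducibleSpace (U Z)
      have hirr : IsIrreducible ((U Z : X.left.Opens) : Set X.left) := Z.2.1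
      exact Subtype.irreducibleSpace hirr
    haveI : IsReduced (EZ Z).left := isReduced_of_smoothOfRelativeDimension (EZ Z).hom d
    exact isIntegral_of_irreducibleSpace_of_isReduced _
  have hclopen : ∀ Z : C, IsClopen (Set.range ⇑(eZ Z).left) := fun Z ↦ by
    rw [hrangeZ]; exact ⟨isClosed_of_mem_irreducibleComponents _ Z.2, hopen Z⟩
  have hirred : ∀ Z : C, IsIrreducible (Set.range ⇑(eZ Z).left) := fun Z ↦ by
    rw [hrangeZ]; exact Z.2.1
  -- the cofan of the components is a colimit of schemes …
  have hdisjZ : ∀ Z₁ Z₂ : C, Z₁ ≠ Z₂ → Disjoint (Z₁.1 : Set X.left) Z₂.1 := fun Z₁ Z₂ hne ↦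
    disjoint_of_mem_irreducibleComponents_of_isOpen Z₁.2 Z₂.2 (hopen Z₂) (fun h ↦ hne (Subtype.ext h))
  have hcov : ⨆ Z : C, (eZ Z).left.opensRange = ⊤ := by
    rw [eq_top_iff]
    rintro x -
    refine TopologicalSpace.Opens.mem_iSup.mpr
      ⟨⟨irreducibleComponent x, irreducibleComponent_mem_irreducibleComponents _⟩, ?_⟩
    rw [hopensRange]
    exact mem_irreducibleComponent
  have hdisj : Pairwise (Function.onFun Disjoint fun Z : C => (eZ Z).left.opensRange) := by
    intro Z₁ Z₂ hne
    change Disjoint (eZ Z₁).left.opensRange (eZ Z₂).left.opensRange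
    rw [hopensRange, hopensRange, ← TopologicalSpace.Opens.coe_disjoint]
    exact hdisjZ Z₁ Z₂ hne
  obtain ⟨hS⟩ := nonempty_isColimit_cofanMk_of (fun Z : C => (eZ Z).left) hcov hdisj
  -- … hence in `SchemeOver K` (`Over.forget` creates colimits)
  have hOver : Nonempty (IsColimit (Cofan.mk X eZ)) := by
    have h2 : IsColimit ((Over.forget (Spec (CommRingCat.of K))).mapCocone (Cofan.mk X eZ)) :=
      (Cofan.isColimitMapCoconeEquiv (Over.forget (Spec (CommRingCat.of K))) EZ (Cofan.mk X eZ)).symm hS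
    exact ⟨isColimitOfReflects (Over.forget _) h2⟩
  exact ⟨C, hfin, EZ, eZ, hsm, hproj, hint, heZopen, hclopen, hirred, hOver⟩

/-! ### A rational point forces `Γ(Z, 𝒪_Z) = L` -/

/-- **An integral scheme, universally closed over a field `L`, with an `L`-rational point has
`Γ(Z, 𝒪_Z) = L`.**  `F = Γ(Z, 𝒪_Z)` is a field (Mathlib `isField_of_universallyClosed`); the point
`z : Spec L → Z` with `z ≫ (Z → Spec L) = 1` gives a retraction `F → L` of `L → F`, injective since
`F` is a field, hence `L → F` is an isomorphism. [folklore] -/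
private theorem isIso_appTop_of_section {L : Type u} [Field L] (Z : SchemeOver L) [IsIntegral Z.left]
    [UniversallyClosed Z.hom] (z : Spec (.of L) ⟶ Z.left) (hz : z ≫ Z.hom = 𝟙 _) :
    IsIso Z.hom.appTop := by
  have hF : IsField Γ(Z.left, ⊤) := isField_of_universallyClosed L Z.hom
  have h1 : Z.hom.appTop ≫ z.appTop = 𝟙 _ := by
    rw [← Scheme.Hom.comp_appTop, hz, Scheme.Hom.id_appTop]
  have key : ∀ y, z.appTop.hom (Z.hom.appTop.hom y) = y := fun y => by
    have h := congrArg (fun φ => φ.hom y) h1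
    simpa only [CommRingCat.hom_comp, RingHom.comp_apply, CommRingCat.hom_id, RingHom.id_apply] using h
  haveI : Nontrivial ↥(Γ(Spec (CommRingCat.of L), ⊤)) :=
    (Scheme.ΓSpecIso (.of L)).commRingCatIsoToRingEquiv.symm.injective.nontrivial
  have hinj : Function.Injective z.appTop.hom := by
    letI := hF.toField
    exact z.appTop.hom.injective
  have h2 : z.appTop ≫ Z.hom.appTop = 𝟙 _ := by
    ext x
    apply hinj
    simp only [CommRingCat.hom_comp, RingHom.comp_apply, CommRingCat.hom_id, RingHom.id_apply]
    exact key _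
  exact ⟨⟨z.appTop, h1, h2⟩⟩

/-- **A smooth projective integral `L`-scheme with an `L`-rational point is a smooth projective
geometrically irreducible variety.**  `Γ(Z, 𝒪_Z) = L` (`isIso_appTop_of_section`), so `Z → Spec L` is
geometrically connected (tree `geometricallyConnected_of_isIso_appTop`, flat base change of `H⁰`) and,
being smooth, geometrically irreducible (tree
`geometricallyIrreducible_of_geometricallyConnected_of_smoothOfRelativeDimension`).
[cite: StacksProject, Tag 04KV (Varieties, Lemma 33.7.14) and Tag 056S] [cite: GortzWedhorn2020, Exercise 3.16] -/
theorem isSmoothProjective_of_section {L : Type u} [Field L] {d : ℕ} (Z : SchemeOver L)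
    (hs : SmoothOfRelativeDimension d Z.hom) (hp : IsProjectiveOver Z) [IsIntegral Z.left]
    (z : Spec (.of L) ⟶ Z.left) (hz : z ≫ Z.hom = 𝟙 _) : IsSmoothProjective d Z := by
  haveI : IsProper Z.hom := hp.isProper
  haveI : CompactSpace Z.left := QuasiCompact.compactSpace_of_compactSpace Z.hom
  haveI : QuasiSeparatedSpace Z.left := quasiSeparatedSpace_of_quasiSeparated Z.hom
  haveI : IsIso Z.hom.appTop := isIso_appTop_of_section Z z hz
  haveI : GeometricallyConnected Z.hom := geometricallyConnected_of_isIso_appTop Z.hom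
  haveI := hs
  exact ⟨hs, hp, geometricallyIrreducible_of_geometricallyConnected_of_smoothOfRelativeDimension Z.hom d⟩

/-! ### One finite Galois extension receiving finitely many finite extensions -/

/-- Finitely many finite extensions `F_i / k` of a field of characteristic zero embed `k`-linearly into
one finite Galois extension `L / k`: the compositum, inside an algebraic closure of `k`, of their normal
closures (normal, finite; separable in characteristic zero). [folklore] -/
private theorem exists_isGalois_algHom {k : Type u} [Field k] [CharZero k] {ι : Type u} [Finite ι]
    (F : ι → Type u) [∀ i, Field (F i)] [∀ i, Algebra k (F i)] [∀ i, FiniteDimensional k (F i)] :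
    ∃ (L : Type u) (_ : Field L) (_ : Algebra k L), FiniteDimensional k L ∧ IsGalois k L ∧
      ∀ i, Nonempty (F i →ₐ[k] L) := by
  haveI : Normal k (⨆ i, IntermediateField.normalClosure k (F i) (AlgebraicClosure k) :
      IntermediateField k (AlgebraicClosure k)) := inferInstance
  haveI : FiniteDimensional k (⨆ i, IntermediateField.normalClosure k (F i) (AlgebraicClosure k) :
      IntermediateField k (AlgebraicClosure k)) := inferInstance
  haveI : Algebra.IsSeparable k (⨆ i, IntermediateField.normalClosure k (F i) (AlgebraicClosure k) :
      IntermediateField k (AlgebraicClosure k)) := Algebra.IsAlgebraic.isSeparable_of_perfectField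
  haveI : IsGalois k (⨆ i, IntermediateField.normalClosure k (F i) (AlgebraicClosure k) :
      IntermediateField k (AlgebraicClosure k)) := ⟨⟩
  refine ⟨↥(⨆ i, IntermediateField.normalClosure k (F i) (AlgebraicClosure k) :
      IntermediateField k (AlgebraicClosure k)), inferInstance, inferInstance, inferInstance, inferInstance,
    fun i => ?_⟩
  have φ : F i →ₐ[k] AlgebraicClosure k := IsAlgClosed.lift
  have hle : φ.fieldRange ≤ ⨆ i, IntermediateField.normalClosure k (F i) (AlgebraicClosure k) :=
    (AlgHom.fieldRange_le_normalClosure φ).trans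
      (le_iSup (fun i => IntermediateField.normalClosure k (F i) (AlgebraicClosure k)) i)
  exact ⟨AlgHom.codRestrict φ
    (⨆ i, IntermediateField.normalClosure k (F i) (AlgebraicClosure k) :
      IntermediateField k (AlgebraicClosure k)).toSubalgebra
    fun x => hle (AlgHom.mem_fieldRange.mpr ⟨x, rfl⟩)⟩

/-! ### Galois translates of rational points -/

/-- **Galois translates of `L`-rational points of `X_L` are `L`-rational**: for an `L`-point
`z₀ : Spec L → X ×_k L` (a section of the projection to `Spec L`) and `γ ∈ Gal(L/k)`,
`Spec γ ≫ z₀ ≫ (1 × Spec γ⁻¹)` is again a section, through the translate of the point of `z₀`. [folklore] -/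
private theorem exists_section_apply_eq_gal {k : Type u} [Field k] (L : Type u) [Field L] [Algebra k L]
    {X : SchemeOver k} (z₀ : Spec (.of L) ⟶ GaloisDescent.bc L X)
    (hz₀ : z₀ ≫ pullback.snd X.hom (bcSpec k L) = 𝟙 _) (γ : L ≃ₐ[k] L) :
    ∃ z₁ : Spec (.of L) ⟶ GaloisDescent.bc L X, z₁ ≫ pullback.snd X.hom (bcSpec k L) = 𝟙 _ ∧
      ∀ q q', z₁ q = GaloisDescent.gal L X γ (z₀ q') := by
  refine ⟨specAut L γ ≫ z₀ ≫ GaloisDescent.gal L X γ, ?_, fun q q' => ?_⟩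
  · rw [Category.assoc, Category.assoc, GaloisDescent.gal_snd, reassoc_of% hz₀,
      specAut_comp_specAut_symm]
  · rw [Scheme.Hom.comp_apply, Scheme.Hom.comp_apply, Subsingleton.elim (specAut L γ q) q']

/-! ### A finite Galois extension splits `X` -/

/-- **[Liu2021, §2.1, proof of the Proposition, first step] A finite Galois extension splits a smooth
projective scheme.**  Let `X` be smooth of relative dimension `d` and projective over a field `k` of
characteristic zero.  Then there is a finite Galois extension `L / k` such that `X_L = X ×_k L` is the
finite coproduct (colimit cofan in `SchemeOver L`) of smooth projective geometrically irreducible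
`L`-varieties `E_c` of dimension `d` — Liu's «`k'` splits `X` (Definition 2.1 (2))», with `k'`
replaced by a finite Galois extension.  See the module docstring for the proof.  Ours.
[cite: Liu2021, §2.1 Def. 2.1 (2) (FJcycle.tex l. 1175–1177) and proof of the Proposition (l. 1194–1196)]
[cite: Liu2002, §3.2 Prop. 2.20] [cite: GortzWedhorn2020, Exercise 3.16 and §(14.20)] -/
theorem exists_isGalois_isColimit_isSmoothProjective {k : Type u} [Field k] [CharZero k] {d : ℕ}
    (X : SchemeOver k) [SmoothOfRelativeDimension d X.hom] (hX : IsProjectiveOver X) :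
    ∃ (L : Type u) (_ : Field L) (_ : Algebra k L) (_ : FiniteDimensional k L) (_ : IsGalois k L)
      (C : Type u) (_ : Finite C) (E : C → SchemeOver L) (e : ∀ c, E c ⟶ (bcFunctor k L).obj X),
      (∀ c, IsSmoothProjective d (E c)) ∧ Nonempty (IsColimit (Cofan.mk ((bcFunctor k L).obj X) e)) := by
  classical
  -- Step 0: `X` is Noetherian, its irreducible components are open
  haveI : IsProper X.hom := hX.isProper
  haveI : IsLocallyNoetherian X.left := LocallyOfFiniteType.isLocallyNoetherian X.hom
  haveI : CompactSpace X.left := (quasiCompact_iff_compactSpace X.hom).mp inferInstance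
  haveI : IsNoetherian X.left := { }
  have hdom : ∀ x : X.left, IsDomain (X.left.presheaf.stalk x) := fun x ↦
    isDomain_stalk_of_smoothOfRelativeDimension X.hom d x
  haveI hfinC : Finite ↥(irreducibleComponents X.left) :=
    (TopologicalSpace.NoetherianSpace.finite_irreducibleComponents (α := X.left)).to_subtype
  have hopen : ∀ W : ↥(irreducibleComponents X.left), IsOpen (W.1 : Set X.left) := fun W ↦
    isOpen_of_mem_irreducibleComponents_of_isDomain_stalk hdom W.2
  -- Step 1: a point on each component, over a finite extension of `k`
  have hpt : ∀ W : ↥(irreducibleComponents X.left), ∃ (F : Type u) (_ : Field F) (_ : Algebra k F),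
      FiniteDimensional k F ∧ ∃ P : Spec (.of F) ⟶ X.left,
        P ≫ X.hom = Spec.map (CommRingCat.ofHom (algebraMap k F)) ∧ ∀ q, P q ∈ (W.1 : Set X.left) := by
    intro W
    let U : X.left.Opens := ⟨W.1, hopen W⟩
    haveI : SmoothOfRelativeDimension d (Over.mk (U.ι ≫ X.hom) : SchemeOver k).hom :=
      IsZariskiLocalAtSource.comp (P := @SmoothOfRelativeDimension d) ‹_› U.ι
    haveI : Smooth (Over.mk (U.ι ≫ X.hom) : SchemeOver k).hom := SmoothOfRelativeDimension.smooth d _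
    haveI : Nonempty (Over.mk (U.ι ≫ X.hom) : SchemeOver k).left := by
      obtain ⟨x, hx⟩ := W.2.1.nonempty
      exact ⟨(⟨x, hx⟩ : U)⟩
    obtain ⟨F, _, _, hfin, -, ⟨P⟩⟩ := exists_algPoints_of_smooth (Over.mk (U.ι ≫ X.hom) : SchemeOver k)
    refine ⟨F, inferInstance, inferInstance, hfin, P.left ≫ U.ι, ?_, fun q => ?_⟩
    · rw [Category.assoc]; exact Over.w P
    · have h := Set.mem_range_self (f := ⇑U.ι) (P.left q)
      rw [Scheme.Opens.range_ι] at h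
      rw [Scheme.Hom.comp_apply]
      exact h
  choose F hF hA hfin P hP hPW using hpt
  -- Step 2: one finite Galois extension `L / k` receiving every `F W`
  obtain ⟨L, _, _, hLfin, hLgal, hemb⟩ := exists_isGalois_algHom (k := k) F
  haveI := hLfin
  haveI := hLgal
  have ψ : ∀ W, F W →ₐ[k] L := fun W => (hemb W).some
  -- Step 3: `X_L` is smooth projective of pure dimension `d`; its components
  have hXL : IsProjectiveOver ((bcFunctor k L).obj X) := hX.baseChange_obj (L := L)
  haveI : SmoothOfRelativeDimension d ((bcFunctor k L).obj X).hom := by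
    haveI := smoothOfRelativeDimension_isStableUnderBaseChange (n := d)
    exact MorphismProperty.pullback_snd _ _ ‹_›
  obtain ⟨C, hC, E, e, hEs, hEp, hEi, heo, hecl, heirr, hcol⟩ :=
    exists_components_isColimit (d := d) ((bcFunctor k L).obj X) hXL
  refine ⟨L, inferInstance, inferInstance, hLfin, hLgal, C, hC, E, e, fun c => ?_, hcol⟩
  -- Step 4: the component `E c` of `X_L` has an `L`-rational point
  haveI := hEi c
  haveI := heo c
  -- `pr : X_L → X` is open (flat of finite presentation), closed (finite) and Galois-homogeneous
  haveI : LocallyOfFinitePresentation (bcSpec k L) := by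
    rw [HasRingHomProperty.Spec_iff (P := @LocallyOfFinitePresentation)]
    exact RingHom.finitePresentation_algebraMap.mpr (Algebra.FinitePresentation.of_finiteType.mp inferInstance)
  haveI : LocallyOfFinitePresentation (pullback.fst X.hom (bcSpec k L)) :=
    MorphismProperty.pullback_fst _ _ inferInstance
  haveI : IsFinite (bcSpec k L) :=
    (IsFinite.SpecMap_iff _).mpr (RingHom.finite_algebraMap.mpr inferInstance)
  haveI : IsFinite (pullback.fst X.hom (bcSpec k L)) := MorphismProperty.pullback_fst _ _ inferInstance
  have hopenmap : IsOpenMap ⇑(pullback.fst X.hom (bcSpec k L)) := (pullback.fst X.hom (bcSpec k L)).isOpenMap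
  have hclosedmap : IsClosedMap ⇑(pullback.fst X.hom (bcSpec k L)) :=
    (pullback.fst X.hom (bcSpec k L)).isClosedMap
  -- the image of the component is clopen, hence contains a whole component `W` of `X`
  obtain ⟨pZ, hpZ⟩ : ∃ pZ : Set ↥X.left,
      pZ = ⇑(pullback.fst X.hom (bcSpec k L)) '' Set.range ⇑(e c).left := ⟨_, rfl⟩
  have hpZo : IsOpen pZ := hpZ ▸ hopenmap _ (hecl c).2
  have hpZc : IsClosed pZ := hpZ ▸ hclosedmap _ (hecl c).1
  obtain ⟨y⟩ : Nonempty ↥(E c).left := inferInstance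
  have hyZ : pullback.fst X.hom (bcSpec k L) ((e c).left y) ∈ pZ := hpZ ▸ ⟨(e c).left y, ⟨y, rfl⟩, rfl⟩
  have hWsub : irreducibleComponent (pullback.fst X.hom (bcSpec k L) ((e c).left y)) ⊆ pZ :=
    (subset_closure_inter_of_isPreirreducible_of_isOpen isIrreducible_irreducibleComponent.isPreirreducible
      hpZo ⟨_, mem_irreducibleComponent, hyZ⟩).trans (closure_minimal Set.inter_subset_right hpZc)
  obtain ⟨W, hW⟩ : ∃ W : ↥(irreducibleComponents X.left),
      W.1 = irreducibleComponent (pullback.fst X.hom (bcSpec k L) ((e c).left y)) :=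
    ⟨⟨_, irreducibleComponent_mem_irreducibleComponents _⟩, rfl⟩
  -- a point `z'` of the component over the chosen point `x_W` of `W`
  have hxW : P W default ∈ pZ := hWsub (hW ▸ hPW W default)
  rw [hpZ] at hxW
  obtain ⟨z', hz'Z, hz'x⟩ := hxW
  -- the `L`-rational point `z₀` of `X_L` over `x_W`, and a Galois translate through `z'`
  have hcomp : (Spec.map (CommRingCat.ofHom (ψ W).toRingHom) ≫ P W) ≫ X.hom = 𝟙 _ ≫ bcSpec k L := by
    rw [Category.assoc, hP W, Category.id_comp, ← Spec.map_comp, ← CommRingCat.ofHom_comp,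
      AlgHom.toRingHom_eq_coe, AlgHom.comp_algebraMap]
  obtain ⟨z₀, hz₀s, hz₀f⟩ : ∃ z₀ : Spec (.of L) ⟶ GaloisDescent.bc L X,
      z₀ ≫ pullback.snd X.hom (bcSpec k L) = 𝟙 _ ∧
      z₀ ≫ pullback.fst X.hom (bcSpec k L) = Spec.map (CommRingCat.ofHom (ψ W).toRingHom) ≫ P W :=
    ⟨pullback.lift _ _ hcomp, pullback.lift_snd _ _ _, pullback.lift_fst _ _ _⟩
  have hpz₀ : ∀ q, pullback.fst X.hom (bcSpec k L) (z₀ q) = P W default := fun q =>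
    (apply_apply_of_comp_eq hz₀f q).trans (by
      rw [Scheme.Hom.comp_apply, Subsingleton.elim (Spec.map _ q) default])
  obtain ⟨q₀⟩ : Nonempty ↥(Spec (CommRingCat.of L)) := inferInstance
  obtain ⟨γ, hγ⟩ := GaloisDescent.exists_gal_apply_eq L X z' (z₀ q₀) (hz'x.trans (hpz₀ q₀).symm)
  obtain ⟨z₁, hz₁s, hz₁q⟩ := exists_section_apply_eq_gal L z₀ hz₀s γ
  -- lift the rational point `z₁` (through `z'`) to the component
  have hrange : Set.range ⇑z₁ ⊆ Set.range ⇑(e c).left := by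
    rintro _ ⟨q, rfl⟩
    obtain ⟨w, hw⟩ := hz'Z
    exact ⟨w, hw.trans (hγ.symm.trans (hz₁q q q₀).symm)⟩
  obtain ⟨z₂, hz₂⟩ : ∃ z₂ : Spec (.of L) ⟶ (E c).left, z₂ ≫ (e c).left = z₁ :=
    ⟨IsOpenImmersion.lift (e c).left z₁ hrange, IsOpenImmersion.lift_fac _ _ _⟩
  have hz₂' : z₂ ≫ (E c).hom = 𝟙 _ := by
    rw [← Over.w (e c), ← Category.assoc, hz₂]
    exact hz₁s
  exact isSmoothProjective_of_section (E c) (hEs c) (hEp c) z₂ hz₂'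

/-- **A finite Galois extension splits a smooth projective scheme into POINTED pieces** — the same as
`exists_isGalois_isColimit_isSmoothProjective`, exporting in addition the `L`-rational point of every piece
that its proof constructs (Step 4: over the chosen point `x_W ∈ W(F_W)` of the component `W` of `X` under the
piece, an `L`-point of `X_L` and a Galois translate of it inside the piece): `X_L ≅ ∐_c E_c` with every `E_c`
smooth projective geometrically irreducible of dimension `d` AND `E_c(L) ≠ ∅`.  Needed where the Albanese
map `f^P : E_c → Alb(E_c)` of a rational point `P` is used (Serre no. 2: `f^P` generates).  Ours.
[cite: Liu2021, §2.1 Def. 2.1 (2) (FJcycle.tex l. 1175–1177) and proof of the Proposition (l. 1194–1196)]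
[cite: GortzWedhorn2020, Exercise 3.16 and §(14.20)] -/
theorem exists_isGalois_isColimit_isSmoothProjective_algPoints {k : Type u} [Field k] [CharZero k] {d : ℕ}
    (X : SchemeOver k) [SmoothOfRelativeDimension d X.hom] (hX : IsProjectiveOver X) :
    ∃ (L : Type u) (_ : Field L) (_ : Algebra k L) (_ : FiniteDimensional k L) (_ : IsGalois k L)
      (C : Type u) (_ : Finite C) (E : C → SchemeOver L) (e : ∀ c, E c ⟶ (bcFunctor k L).obj X),
      (∀ c, IsSmoothProjective d (E c)) ∧ (∀ c, Nonempty (AlgPoints (E c) L)) ∧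
        Nonempty (IsColimit (Cofan.mk ((bcFunctor k L).obj X) e)) := by
  classical
  -- Step 0: `X` is Noetherian, its irreducible components are open
  haveI : IsProper X.hom := hX.isProper
  haveI : IsLocallyNoetherian X.left := LocallyOfFiniteType.isLocallyNoetherian X.hom
  haveI : CompactSpace X.left := (quasiCompact_iff_compactSpace X.hom).mp inferInstance
  haveI : IsNoetherian X.left := { }
  have hdom : ∀ x : X.left, IsDomain (X.left.presheaf.stalk x) := fun x ↦
    isDomain_stalk_of_smoothOfRelativeDimension X.hom d x
  haveI hfinC : Finite ↥(irreducibleComponents X.left) :=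
    (TopologicalSpace.NoetherianSpace.finite_irreducibleComponents (α := X.left)).to_subtype
  have hopen : ∀ W : ↥(irreducibleComponents X.left), IsOpen (W.1 : Set X.left) := fun W ↦
    isOpen_of_mem_irreducibleComponents_of_isDomain_stalk hdom W.2
  -- Step 1: a point on each component, over a finite extension of `k`
  have hpt : ∀ W : ↥(irreducibleComponents X.left), ∃ (F : Type u) (_ : Field F) (_ : Algebra k F),
      FiniteDimensional k F ∧ ∃ P : Spec (.of F) ⟶ X.left,
        P ≫ X.hom = Spec.map (CommRingCat.ofHom (algebraMap k F)) ∧ ∀ q, P q ∈ (W.1 : Set X.left) := by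
    intro W
    let U : X.left.Opens := ⟨W.1, hopen W⟩
    haveI : SmoothOfRelativeDimension d (Over.mk (U.ι ≫ X.hom) : SchemeOver k).hom :=
      IsZariskiLocalAtSource.comp (P := @SmoothOfRelativeDimension d) ‹_› U.ι
    haveI : Smooth (Over.mk (U.ι ≫ X.hom) : SchemeOver k).hom := SmoothOfRelativeDimension.smooth d _
    haveI : Nonempty (Over.mk (U.ι ≫ X.hom) : SchemeOver k).left := by
      obtain ⟨x, hx⟩ := W.2.1.nonempty
      exact ⟨(⟨x, hx⟩ : U)⟩
    obtain ⟨F, _, _, hfin, -, ⟨P⟩⟩ := exists_algPoints_of_smooth (Over.mk (U.ι ≫ X.hom) : SchemeOver k)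
    refine ⟨F, inferInstance, inferInstance, hfin, P.left ≫ U.ι, ?_, fun q => ?_⟩
    · rw [Category.assoc]; exact Over.w P
    · have h := Set.mem_range_self (f := ⇑U.ι) (P.left q)
      rw [Scheme.Opens.range_ι] at h
      rw [Scheme.Hom.comp_apply]
      exact h
  choose F hF hA hfin P hP hPW using hpt
  -- Step 2: one finite Galois extension `L / k` receiving every `F W`
  obtain ⟨L, _, _, hLfin, hLgal, hemb⟩ := exists_isGalois_algHom (k := k) F
  haveI := hLfin
  haveI := hLgal
  have ψ : ∀ W, F W →ₐ[k] L := fun W => (hemb W).some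
  -- Step 3: `X_L` is smooth projective of pure dimension `d`; its components
  have hXL : IsProjectiveOver ((bcFunctor k L).obj X) := hX.baseChange_obj (L := L)
  haveI : SmoothOfRelativeDimension d ((bcFunctor k L).obj X).hom := by
    haveI := smoothOfRelativeDimension_isStableUnderBaseChange (n := d)
    exact MorphismProperty.pullback_snd _ _ ‹_›
  obtain ⟨C, hC, E, e, hEs, hEp, hEi, heo, hecl, heirr, hcol⟩ :=
    exists_components_isColimit (d := d) ((bcFunctor k L).obj X) hXL
  -- Step 4: every component `E c` of `X_L` has an `L`-rational point (a section of `E c → Spec L`)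
  suffices key : ∀ c, ∃ z₂ : Spec (.of L) ⟶ (E c).left, z₂ ≫ (E c).hom = 𝟙 _ by
    refine ⟨L, inferInstance, inferInstance, hLfin, hLgal, C, hC, E, e, fun c => ?_, fun c => ?_, hcol⟩
    · obtain ⟨z₂, hz₂'⟩ := key c
      haveI := hEi c
      exact isSmoothProjective_of_section (E c) (hEs c) (hEp c) z₂ hz₂'
    · obtain ⟨z₂, hz₂'⟩ := key c
      refine ⟨AlgPoints.mk z₂ ?_⟩
      rw [hz₂', Algebra.algebraMap_self, CommRingCat.ofHom_id, Spec.map_id]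
  intro c
  haveI := hEi c
  haveI := heo c
  -- `pr : X_L → X` is open (flat of finite presentation), closed (finite) and Galois-homogeneous
  haveI : LocallyOfFinitePresentation (bcSpec k L) := by
    rw [HasRingHomProperty.Spec_iff (P := @LocallyOfFinitePresentation)]
    exact RingHom.finitePresentation_algebraMap.mpr (Algebra.FinitePresentation.of_finiteType.mp inferInstance)
  haveI : LocallyOfFinitePresentation (pullback.fst X.hom (bcSpec k L)) :=
    MorphismProperty.pullback_fst _ _ inferInstance
  haveI : IsFinite (bcSpec k L) :=
    (IsFinite.SpecMap_iff _).mpr (RingHom.finite_algebraMap.mpr inferInstance)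
  haveI : IsFinite (pullback.fst X.hom (bcSpec k L)) := MorphismProperty.pullback_fst _ _ inferInstance
  have hopenmap : IsOpenMap ⇑(pullback.fst X.hom (bcSpec k L)) := (pullback.fst X.hom (bcSpec k L)).isOpenMap
  have hclosedmap : IsClosedMap ⇑(pullback.fst X.hom (bcSpec k L)) :=
    (pullback.fst X.hom (bcSpec k L)).isClosedMap
  -- the image of the component is clopen, hence contains a whole component `W` of `X`
  obtain ⟨pZ, hpZ⟩ : ∃ pZ : Set ↥X.left,
      pZ = ⇑(pullback.fst X.hom (bcSpec k L)) '' Set.range ⇑(e c).left := ⟨_, rfl⟩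
  have hpZo : IsOpen pZ := hpZ ▸ hopenmap _ (hecl c).2
  have hpZc : IsClosed pZ := hpZ ▸ hclosedmap _ (hecl c).1
  obtain ⟨y⟩ : Nonempty ↥(E c).left := inferInstance
  have hyZ : pullback.fst X.hom (bcSpec k L) ((e c).left y) ∈ pZ := hpZ ▸ ⟨(e c).left y, ⟨y, rfl⟩, rfl⟩
  have hWsub : irreducibleComponent (pullback.fst X.hom (bcSpec k L) ((e c).left y)) ⊆ pZ :=
    (subset_closure_inter_of_isPreirreducible_of_isOpen isIrreducible_irreducibleComponent.isPreirreducible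
      hpZo ⟨_, mem_irreducibleComponent, hyZ⟩).trans (closure_minimal Set.inter_subset_right hpZc)
  obtain ⟨W, hW⟩ : ∃ W : ↥(irreducibleComponents X.left),
      W.1 = irreducibleComponent (pullback.fst X.hom (bcSpec k L) ((e c).left y)) :=
    ⟨⟨_, irreducibleComponent_mem_irreducibleComponents _⟩, rfl⟩
  -- a point `z'` of the component over the chosen point `x_W` of `W`
  have hxW : P W default ∈ pZ := hWsub (hW ▸ hPW W default)
  rw [hpZ] at hxW
  obtain ⟨z', hz'Z, hz'x⟩ := hxW
  -- the `L`-rational point `z₀` of `X_L` over `x_W`, and a Galois translate through `z'`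
  have hcomp : (Spec.map (CommRingCat.ofHom (ψ W).toRingHom) ≫ P W) ≫ X.hom = 𝟙 _ ≫ bcSpec k L := by
    rw [Category.assoc, hP W, Category.id_comp, ← Spec.map_comp, ← CommRingCat.ofHom_comp,
      AlgHom.toRingHom_eq_coe, AlgHom.comp_algebraMap]
  obtain ⟨z₀, hz₀s, hz₀f⟩ : ∃ z₀ : Spec (.of L) ⟶ GaloisDescent.bc L X,
      z₀ ≫ pullback.snd X.hom (bcSpec k L) = 𝟙 _ ∧
      z₀ ≫ pullback.fst X.hom (bcSpec k L) = Spec.map (CommRingCat.ofHom (ψ W).toRingHom) ≫ P W :=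
    ⟨pullback.lift _ _ hcomp, pullback.lift_snd _ _ _, pullback.lift_fst _ _ _⟩
  have hpz₀ : ∀ q, pullback.fst X.hom (bcSpec k L) (z₀ q) = P W default := fun q =>
    (apply_apply_of_comp_eq hz₀f q).trans (by
      rw [Scheme.Hom.comp_apply, Subsingleton.elim (Spec.map _ q) default])
  obtain ⟨q₀⟩ : Nonempty ↥(Spec (CommRingCat.of L)) := inferInstance
  obtain ⟨γ, hγ⟩ := GaloisDescent.exists_gal_apply_eq L X z' (z₀ q₀) (hz'x.trans (hpz₀ q₀).symm)
  obtain ⟨z₁, hz₁s, hz₁q⟩ := exists_section_apply_eq_gal L z₀ hz₀s γ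
  -- lift the rational point `z₁` (through `z'`) to the component
  have hrange : Set.range ⇑z₁ ⊆ Set.range ⇑(e c).left := by
    rintro _ ⟨q, rfl⟩
    obtain ⟨w, hw⟩ := hz'Z
    exact ⟨w, hw.trans (hγ.symm.trans (hz₁q q q₀).symm)⟩
  obtain ⟨z₂, hz₂⟩ : ∃ z₂ : Spec (.of L) ⟶ (E c).left, z₂ ≫ (e c).left = z₁ :=
    ⟨IsOpenImmersion.lift (e c).left z₁ hrange, IsOpenImmersion.lift_fac _ _ _⟩
  have hz₂' : z₂ ≫ (E c).hom = 𝟙 _ := by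
    rw [← Over.w (e c), ← Category.assoc, hz₂]
    exact hz₁s
  exact ⟨z₂, hz₂'⟩

end Literature.NumberTheory.Automorphic.Liu2021.AppendixC

end
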